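import Mathlib
import Summits.Ventures.PercRepro2.SharpT2
import Summits.Ventures.PercRepro2.ReachBits
import Summits.Ventures.PercRepro2.MixedBoxDefs
import Summits.Ventures.PercRepro2.CellMonoRefutation

/-!
# SHARP-T2 is FALSE: a kernel-checked refutation of `SharpHalves.SharpT2_all`
(blind cell PercRepro2, night-1 g36; proofs/NIGHT1-G36.md §0′ 5 — ERRATUM to the census sentence of
`SharpT2.lean`)

`SharpHalves.SharpT2 p ends o a₁ a₂ a₃ b` is `0 ≤ SLT2` with `SLT2 = D P(Q) · SLT + oLSlack · X`, i.e.
`μ(T) Cov_T(bL, oL) + μ(T) μ(R) (P(bL|R) − P(bL|T)) (P(oL|PD) − P(oL|T)) ≥ 0` — the `T`-world form of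
HALF-L at the centring `c₂` WITHOUT the `R`-slack `SLR ≥ 0`.  It survived three kit jobs (30,000 weight
climbs) and was refuted by the fourth (j336220/1/3: 1 + 5 + 3 exact negatives, own code, exact re-check):
the `R`-slack is needed.  SHARP-L2 (= HALF-L at `c₂`, `SharpL2.lean`) stands (0 exact negatives in
107,000 climbs).

THE WITNESS (7 vertices, 9 edges; the climb's witness with its three near-zero edges deleted and the
weights rounded to tenths): vertices `o = 0`, `a₃ = 1`, `a₂ = 2`, `b = 3`, `4`, `a₁ = 5`, `6`;
edges `2–3, 3–5` (weight `9/10`), `1–6` (`1/2`), `0–4` (`1/2`), `2–6` (`9/10`), `4–5` (`9/10`), `4–6` (`2/5`),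
`2–4` (`9/10`), `3–6` (`2/5`).  With the integer weight `wt ω = ∏_e (num_e if e open else 10 − num_e)`
(`D = 10⁹`) the nine masses are

  `m(T) = 11 161 800`, `m(T,bL) = 3 839 400`, `m(T,oL) = 1 919 700`, `m(T,bL,oL) = 656 100`,
  `m(R) = 13 533 400`, `m(PD) = 13 043 800`, `m(PD,oL) = 2 429 100`, `m(Q) = 24 695 200`, `m(Q,bL) = 9 079 200`,

and `SLT2 · D⁵ = m(PD) m(Q) · m(R) [m(T) m(T,bL,oL) − m(T,bL) m(T,oL)]`
`+ m(R) [m(PD,oL) m(T) − m(T,oL) m(PD)] · [m(Q,bL) m(T) − m(T,bL) m(Q)] = −22 867 723 799 159 279 938 560 000 000 000 < 0`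
(the `T`-part `−2.06·10³²` against the drop product `+1.83·10³²`).  Here `P(Q) ≈ 2.5·10⁻²` (the roots are
joined by the strong path `5–3–2`), `μ(T) = 0.45`, `μ(PD) = 0.53`.

The masses are decided by the kernel with the bitmask reachability of `ReachBits.decConnB`
(`decide +kernel`, nine edges as in `CellMonoRefutation.mass_eq_sum9`); standard axioms; one seat.
-/

namespace Summit.Ventures.PercRepro2

namespace SharpT2Refutation

open UnionCluster CovForm SharpHalves

/-- The nine edges of the witness on the vertices `0..6`. -/
def ends : Fin 9 → Sym2 (Fin 7) :=
  ![s(2, 3), s(3, 5), s(1, 6), s(0, 4), s(2, 6), s(4, 5), s(4, 6), s(2, 4), s(3, 6)]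

/-- The numerators of the edge weights (denominator `10`). -/
def num : Fin 9 → ℕ := ![9, 9, 5, 5, 9, 9, 4, 9, 4]

/-- The edge weights `num e / 10`. -/
def p : Fin 9 → ℚ := fun e => (num e : ℚ) / 10

/-- The integer weight of a configuration: `∏_e (num e if e open else 10 − num e)`. -/
def wt : Config (Fin 9) → ℕ := fun ω => ∏ e, (if ω e then num e else 10 - num e)

/-- Every numerator is at most `10`. -/
lemma num_le (e : Fin 9) : num e ≤ 10 := by fin_cases e <;> decide

/-- The weights are admissible. -/
lemma p_isProbVec : IsProbVec p :=
  ⟨fun e => by unfold p; positivity,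
   fun e => by
    unfold p
    have h : (num e : ℚ) ≤ 10 := by exact_mod_cast num_le e
    linarith [div_le_one_of_le₀ h (by norm_num : (0 : ℚ) ≤ 10)]⟩

/-- One Bernoulli factor as an integer numerator over `10`. -/
lemma edgeFactor_eq (e : Fin 9) (b : Bool) :
    edgeFactor (p e) b = ((if b then num e else 10 - num e : ℕ) : ℚ) / 10 := by
  cases b
  · have h : num e ≤ 10 := num_le e
    simp only [edgeFactor_false, p, Bool.false_eq_true, ↓reduceIte]
    rw [Nat.cast_sub h]
    push_cast
    ring
  · simp [edgeFactor_true, p]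

/-- `weight p ω = wt ω / 10⁹`. -/
lemma weight_eq (ω : Config (Fin 9)) : weight p ω = (wt ω : ℚ) / 10 ^ 9 := by
  unfold weight wt
  simp only [edgeFactor_eq]
  rw [Finset.prod_div_distrib, Finset.prod_const, Finset.card_univ, Fintype.card_fin, Nat.cast_prod]

/-- The bitmask decision of `Conn` on the witness (`ReachBits.decConnB`). -/
instance instDecConnFast (ω : Config (Fin 9)) : DecidableRel (Conn ends ω) := fun u v =>
  decConnB ends ω u v

/-- Membership in a connection event is decidable (fast). -/
instance instDecConnEvent (u v : Fin 7) : DecidablePred (· ∈ connEvent ends u v) := fun ω =>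
  inferInstanceAs (Decidable (Conn ends ω u v))

/-- Membership in `T = {a₂ ↮ a₁, a₂ ↔ a₃}` is decidable (fast). -/
instance instDecT (a₁ a₂ a₃ : Fin 7) : DecidablePred (· ∈ TEvent ends a₁ a₂ a₃) := fun ω =>
  inferInstanceAs (Decidable (ω ∈ (connEvent ends a₂ a₁)ᶜ ∩ connEvent ends a₂ a₃))

/-- Membership in `PD = {a₁ ↮ a₂} ∩ {a₃ ∉ C(a₁) ∪ C(a₂)}` is decidable (fast). -/
instance instDecPD (a₁ a₂ a₃ : Fin 7) : DecidablePred (· ∈ PDEvent ends a₁ a₂ a₃) := fun ω =>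
  inferInstanceAs (Decidable (ω ∈ (connEvent ends a₁ a₂)ᶜ ∩
    (connEvent ends a₃ a₁ ∪ connEvent ends a₃ a₂)ᶜ))

/-- Membership in `R = avoidAll ends 2 {5, 1}` is decidable (fast). -/
instance instDecR : DecidablePred (· ∈ avoidAll ends 2 {5, 1}) := fun ω =>
  inferInstanceAs (Decidable (∀ x ∈ ({5, 1} : Finset (Fin 7)), ¬ Conn ends ω 2 x))

/-- Membership in `Q = avoidAll ends 2 {5}` is decidable (fast). -/
instance instDecQ : DecidablePred (· ∈ avoidAll ends 2 {5}) := fun ω =>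
  inferInstanceAs (Decidable (∀ x ∈ ({5} : Finset (Fin 7)), ¬ Conn ends ω 2 x))

set_option maxRecDepth 100000 in
set_option maxHeartbeats 16000000 in
/-- `m(T) = 11 161 800`. -/
theorem mass_T : MixedBox.mass wt (TEvent ends 5 2 1) = 11161800 := by
  rw [CellMonoRefutation.mass_eq_sum9]
  decide +kernel

set_option maxRecDepth 100000 in
set_option maxHeartbeats 16000000 in
/-- `m(T, bL) = 3 839 400`. -/
theorem mass_TbL : MixedBox.mass wt (TEvent ends 5 2 1 ∩ connEvent ends 5 3) = 3839400 := by
  rw [CellMonoRefutation.mass_eq_sum9]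
  decide +kernel

set_option maxRecDepth 100000 in
set_option maxHeartbeats 16000000 in
/-- `m(T, oL) = 1 919 700`. -/
theorem mass_ToL : MixedBox.mass wt (TEvent ends 5 2 1 ∩ connEvent ends 5 0) = 1919700 := by
  rw [CellMonoRefutation.mass_eq_sum9]
  decide +kernel

set_option maxRecDepth 100000 in
set_option maxHeartbeats 16000000 in
/-- `m(T, bL, oL) = 656 100`. -/
theorem mass_TbLoL :
    MixedBox.mass wt (TEvent ends 5 2 1 ∩ (connEvent ends 5 0 ∩ connEvent ends 5 3)) = 656100 := by
  rw [CellMonoRefutation.mass_eq_sum9]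
  decide +kernel

set_option maxRecDepth 100000 in
set_option maxHeartbeats 16000000 in
/-- `m(R) = 13 533 400`. -/
theorem mass_R : MixedBox.mass wt (avoidAll ends 2 {5, 1}) = 13533400 := by
  rw [CellMonoRefutation.mass_eq_sum9]
  decide +kernel

set_option maxRecDepth 100000 in
set_option maxHeartbeats 16000000 in
/-- `m(PD) = 13 043 800`. -/
theorem mass_PD : MixedBox.mass wt (PDEvent ends 5 2 1) = 13043800 := by
  rw [CellMonoRefutation.mass_eq_sum9]
  decide +kernel

set_option maxRecDepth 100000 in
set_option maxHeartbeats 16000000 in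
/-- `m(PD, oL) = 2 429 100`. -/
theorem mass_PDoL : MixedBox.mass wt (PDEvent ends 5 2 1 ∩ connEvent ends 5 0) = 2429100 := by
  rw [CellMonoRefutation.mass_eq_sum9]
  decide +kernel

set_option maxRecDepth 100000 in
set_option maxHeartbeats 16000000 in
/-- `m(Q) = 24 695 200`. -/
theorem mass_Q : MixedBox.mass wt (avoidAll ends 2 {5}) = 24695200 := by
  rw [CellMonoRefutation.mass_eq_sum9]
  decide +kernel

set_option maxRecDepth 100000 in
set_option maxHeartbeats 16000000 in
/-- `m(Q, bL) = 9 079 200`. -/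
theorem mass_QbL : MixedBox.mass wt (avoidAll ends 2 {5} ∩ connEvent ends 5 3) = 9079200 := by
  rw [CellMonoRefutation.mass_eq_sum9]
  decide +kernel

/-- **SHARP-T2 fails on the witness** at `(o, a₁, a₂, a₃, b) = (0, 5, 2, 1, 3)`:
`SLT2 = −22 867 723 799 159 279 938 560 000 000 000 · 10⁻⁴⁵ < 0`. -/
theorem not_SharpT2 : ¬ SharpT2 p ends 0 5 2 1 3 := by
  unfold SharpT2 SLT2 SLT oLSlack bLSlack
  rw [MixedBox.prob_eq_mass_div weight_eq, MixedBox.prob_eq_mass_div weight_eq,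
    MixedBox.prob_eq_mass_div weight_eq, MixedBox.prob_eq_mass_div weight_eq,
    MixedBox.prob_eq_mass_div weight_eq, MixedBox.prob_eq_mass_div weight_eq,
    MixedBox.prob_eq_mass_div weight_eq, MixedBox.prob_eq_mass_div weight_eq,
    MixedBox.prob_eq_mass_div weight_eq,
    mass_T, mass_TbL, mass_ToL, mass_TbLoL, mass_R, mass_PD, mass_PDoL, mass_Q, mass_QbL]
  norm_num

/-- **`SharpT2_all ℚ` is false**: SHARP-T2 does not hold for every finite graph and every labelling. -/
theorem not_SharpT2_all : ¬ SharpT2_all ℚ := fun h =>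
  not_SharpT2 (h (Fin 7) (Fin 9) ends p p_isProbVec 0 5 2 1 3 (by decide) (by decide) (by decide)
    (by decide) (by decide) (by decide) (by decide) (by decide) (by decide) (by decide))

end SharpT2Refutation

end Summit.Ventures.PercRepro2
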